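import Summits.QuantumFields.BalabanUV.Beta.FP.PerfectPolarization
import Summits.QuantumFields.BalabanUV.Beta.FP.PerfectPropagatorSymbolPerm
import Literature.MathematicalPhysics.QuantumFieldTheory.Balaban1983to89.Beta.KernelReflection
import Literature.MathematicalPhysics.QuantumFieldTheory.Balaban1983to89.B4Green244

/-!
# `BalabanUV.Beta.FP.PerfectPropagatorReflection` — road «FP» for binder row D1, sub-row **H2-ASM-5a** (symmetry letters of `PiBF`), REFLECTION HALF (Kcov), module R2 layer b:
# THE SINGLE-AXIS REFLECTION LAW OF THE EXPLICIT PERFECT PROPAGATOR KERNEL `PinfKer` and the leg letters (L-REFL-P) `refK Φα Pker = Pker`, (L-REFL-G) `refK Ψα G0ker = G0ker`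
# of `PerfectPolarizationReflection.axisReflectionCovariant_flip_PiBF`, DERIVED from the momentum-space letters `PinfSym_phase` + `W166Inf_cflip` by a change of variables on the zone

HONEST DEPENDENCY (page 1, mandatory): continuum YM on T⁴ ⇐ BetaPertH ∧ nine spine estimates (0/9 proved); BetaPertH ⇐ (D1) ∧ (D4) ∧ CAP+tail;
G-an2-4 gates asym, D1 and NE2/3/4.  HONEST FRAMING (cell contract, verbatim): «discharging `BetaPertH` makes Bałaban's UV stability UNCONDITIONAL —
a real constructive-QFT result; it is NOT the continuum limit and NOT the Clay problem.»  THIS MODULE DISCHARGES NOTHING of the wall: [folklore] Fourier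
analysis on `ℤ^{d+1}` (a single-axis momentum flip is a measure-preserving involution of the zone; a unit-modulus phase multiplier shifts the site) applied to
the road's EXPLICIT data defs `PinfKer` (`FP/PerfectPropagatorKernel`), `Pker`∕`G0ker` (`FP/PerfectPolarization`), with beta-d1-formalise-leaf-01's momentum-space letters
`PerfectPropagatorSymbolPerm.PinfSym_phase`∕`rebasing_phase` and `PerfectSymbolPerm.W166Inf_cflip` BY NAME; 0 def, 0 `def … : Prop`, nothing cited, 0 sorry;
0∕4 row-D1 binders; NOT the vertex-side (a7) letters, NOT hgerm, NOT D1, NOT BetaPertH, NOT continuum, NOT Clay.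

ABSOLUTE RULE (cell charter, verbatim): «No internally-minted statement may enter as a cited fact. Every hypothesis is either kernel-proved in this package or a
verbatim quotation of a PUBLISHED theorem with page reference. The manuscript(s) under audit are NOT citable for their own disputed steps — they are the thing
under adjudication; programme-internal (2001/route/tribunal) claims are never citable.»

CONTENT ([folklore]∕[our object]): §1 momentum side — `d1Sym_cflip` (the forward-difference symbol at the flipped momentum is the unit-modulus re-basing phase
`a ↦ [a = α](−e^{−is_α}) + [a ≠ α]` times the original, `rebasing_phase`), `PinfSym_cflip_weights` (`W166Inf_cflip`), **`symP_cflip`** (`= c_β · symP β γ q · conj c_γ`, `PinfSym_phase`);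
§2 lattice side — `cflip_mem_BZ_iff`, `measurePreserving_cflip`, **`latticeKernel_cflip`** (`K[G](cflip α x) = K[G ∘ cflip α](x)`); §3 **`PinfKer_cflip`** ∕ **`PinfKer_axisReflect`**:
`PinfKer β γ (εx − [β=α]e_α + [γ=α]e_α) = ε_β ε_γ · PinfKer β γ x` (`ε = reflSign α`), i.e. **`axisReflectionCovariant_re_PinfKer`**: `Re PinfKer`, read as a two-index kernel of ONE
lattice variable, satisfies `PolarizationSign.AxisReflectionCovariant` verbatim; §4 **(L-REFL-P) `refK_Pker_eq_of_legMap`**: `refK Φ Pker = Pker` for EVERY `Φ : LegMap 4 (Fib 3)` whose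
FIELD legs are relabelled by `y ↦ εy + [β=α]e_α` with signs `reflSign α β` (multiplier legs arbitrary — `Pker` vanishes there), `exists_legMap_refK_Pker`; §5 **(L-REFL-G)**
`latticeGreen_cflip`, **`refK_G0ker_eq_of_legMap`** (`y ↦ εy + c•e_α`, any `c`), `exists_legMap_refK_G0ker`.
ORIENTATION REMARK (located, asserted nowhere): the field-leg shift leaving `Pker x z (inl β) (inl γ) = Re PinfKer β γ (z − x)` invariant is `+[β=α]e_α`, the mirror image of the
geometric re-basing `−[β=α]e_α` of a reflected `α`-bond — `Pker`'s difference variable is (second leg) − (first leg), the printed `Π_{μν}(x − y)` read at `−(x − y)` (cf.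
`KernelReflection`'s ORIENTATION REMARK, `OneStepKernelFamily.flipK`); the vertex-side (a7) letters of `axisReflectionCovariant_flip_PiBF` must be supplied against THIS `Φ`.
Provenance: D1 formalisation swarm seat b2b-balaban-beta-d1-formalise-leaf-02 gen 9 (road FP engine lineage; sub-row H2-ASM-5a (Kcov) REFLECTION HALF, «MINE (Kcov)» journal l.26728), 2026-08-21.
-/

noncomputable section

namespace Summit.QuantumFields.BalabanUV.Beta.FP.PerfectPropagatorReflection

open MeasureTheory Set Complex Finset Matrix
open scoped Real BigOperators ComplexConjugate
open Literature.MathematicalPhysics.QuantumFieldTheory.Balaban1983to89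
open Literature.MathematicalPhysics.QuantumFieldTheory.Balaban1983to89.Beta
open B4Strip (ofRealVec)
open B4ContourShift (BZ phase integrand fourierBox latticeKernel)
open B4Green244 (phaseC phaseC_ofRealVec latticeKernel_phase_mul latticeKernel_congr)
open B4Green242Bridge (latticeKernel_const_mul)
open B5Prop11Fiber (d1Sym)
open B6BondElimination (unitVec unitVec_apply)
open PolarizationSign (axisReflect axisReflect_apply reflSign AxisReflectionCovariant)
open ExpKernelCalculus (MKer Site)
open OneStepResolventKernel (Fib)
open KernelReflection (LegMap refK refK_apply)
open Literature.Probability.LatticeModels (latticeGreen brillouin dispersion)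
open Summit.QuantumFields.BalabanUV.Beta.FP.PerfectSymbol166 (W166Inf)
open Summit.QuantumFields.BalabanUV.Beta.FP.PerfectSymbolPerm (cflip cflip_apply cflip_cflip W166Inf_cflip)
open Summit.QuantumFields.BalabanUV.Beta.FP.PerfectPropagatorSymbol (PinfSym)
open Summit.QuantumFields.BalabanUV.Beta.FP.PerfectPropagatorSymbolPerm (PinfSym_phase rebasing_phase norm_rebasing_phase self_mul_conj_of_norm)
open Summit.QuantumFields.BalabanUV.Beta.FP.PerfectPropagatorKernel (reVec symP PinfKer reVec_ofRealVec)
open Summit.QuantumFields.BalabanUV.Beta.FP.PerfectPolarization (Pker G0ker Pker_inl_inl Pker_inl_inr Pker_inr_inl Pker_inr_inr G0ker_apply)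

variable {d : ℕ}

/-! ## §1 Momentum side: the symbol at the flipped momentum -/

/-- [folklore] passing to complex momenta commutes with the coordinate flip. -/
theorem ofRealVec_cflip (α : Fin (d + 1)) (s : Fin (d + 1) → ℝ) : ofRealVec (cflip α s) = cflip α (ofRealVec s) := by
  funext i
  by_cases hi : i = α <;> simp [ofRealVec, cflip_apply, hi]

/-- [folklore] taking real parts commutes with the coordinate flip. -/
theorem reVec_cflip (α : Fin (d + 1)) (q : Fin (d + 1) → ℂ) : reVec (cflip α q) = cflip α (reVec q) := by
  funext i
  by_cases hi : i = α <;> simp [reVec, cflip_apply, hi]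

/-- [folklore] the unit-modulus re-basing phases of the flip of axis `α` at the real momentum `s`. -/
theorem norm_rebasePhase (α : Fin (d + 1)) (s : Fin (d + 1) → ℝ) (a : Fin (d + 1)) :
    ‖(fun a : Fin (d + 1) => if a = α then -cexp (-(I * (s α : ℂ))) else (1 : ℂ)) a‖ = 1 := by
  by_cases ha : a = α
  · simp only [ha, if_true]; exact norm_rebasing_phase (s α)
  · simp only [ha, if_false, norm_one]

/-- [folklore] **THE FORWARD-DIFFERENCE SYMBOL AT THE FLIPPED MOMENTUM** is the re-basing phase times the original:
`∂̂(cflip α s) = c · ∂̂(s)`, `c_a = [a = α](−e^{−is_α}) + [a ≠ α]` (`rebasing_phase`). -/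
theorem d1Sym_cflip (α : Fin (d + 1)) (s : Fin (d + 1) → ℝ) :
    d1Sym (cflip α s) = (fun a : Fin (d + 1) => if a = α then -cexp (-(I * (s α : ℂ))) else (1 : ℂ)) * d1Sym s := by
  funext a
  simp only [Pi.mul_apply, d1Sym, cflip_apply]
  by_cases ha : a = α
  · subst ha
    simp only [if_true, Complex.ofReal_neg]
    have h := rebasing_phase (s a)
    rw [show -(s a : ℂ) * I = -(I * (s a : ℂ)) by ring, show (s a : ℂ) * I = I * (s a : ℂ) by ring]
    exact h
  · simp only [ha, if_false, one_mul]

/-- [folklore] the `W_∞` weights of the Feynman-completed symbol are flip-even (`W166Inf_cflip`), hence so is `PinfSym` in its first argument. -/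
theorem PinfSym_cflip_weights (α : Fin (d + 1)) (s : Fin (d + 1) → ℝ) (ph : Fin (d + 1) → ℂ) :
    PinfSym (cflip α s) ph = PinfSym s ph := by
  unfold PinfSym
  have e : (fun μ ν => (W166Inf μ ν (ofRealVec (cflip α s))).re) = fun μ ν => (W166Inf μ ν (ofRealVec s)).re := by
    funext μ ν
    rw [ofRealVec_cflip, W166Inf_cflip]
  rw [e]

/-- [folklore] **THE PERFECT PROPAGATOR SYMBOL AT THE FLIPPED MOMENTUM**: `symP β γ (cflip α q) = c_β · symP β γ q · conj c_γ` with the re-basing phases of §1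
(`PinfSym_phase` for the unit-modulus `c`, `d1Sym_cflip`, `PinfSym_cflip_weights`). -/
theorem symP_cflip (α β γ : Fin (d + 1)) (q : Fin (d + 1) → ℂ) :
    symP β γ (cflip α q)
      = (fun a : Fin (d + 1) => if a = α then -cexp (-(I * ((reVec q) α : ℂ))) else (1 : ℂ)) β * symP β γ q
        * conj ((fun a : Fin (d + 1) => if a = α then -cexp (-(I * ((reVec q) α : ℂ))) else (1 : ℂ)) γ) := by
  unfold symP
  rw [reVec_cflip, PinfSym_cflip_weights, d1Sym_cflip, PinfSym_phase (norm_rebasePhase α (reVec q)), Matrix.mul_diagonal,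
    Matrix.diagonal_mul]
  simp only [Pi.star_apply, Complex.star_def]

/-! ## §2 Lattice side: the single-axis flip is a symmetry of the zone integral -/

/-- [folklore] membership in the zone is a coordinatewise absolute-value bound. -/
theorem mem_BZ_iff_abs (p : Fin (d + 1) → ℝ) : p ∈ BZ (d + 1) ↔ ∀ i, |p i| ≤ π := by
  simp only [BZ, Set.mem_Icc, Pi.le_def, abs_le]
  exact ⟨fun h i => ⟨h.1 i, h.2 i⟩, fun h => ⟨fun i => (h i).1, fun i => (h i).2⟩⟩

/-- [folklore] the Brillouin zone is invariant under the flip of one coordinate. -/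
theorem cflip_mem_BZ_iff (α : Fin (d + 1)) (p : Fin (d + 1) → ℝ) : cflip α p ∈ BZ (d + 1) ↔ p ∈ BZ (d + 1) := by
  simp only [mem_BZ_iff_abs]
  refine forall_congr' fun i => ?_
  by_cases hi : i = α
  · rw [cflip_apply, if_pos hi, abs_neg]
  · rw [cflip_apply, if_neg hi]

/-- [folklore] hence `(cflip α)⁻¹' BZ = BZ`. -/
theorem cflip_preimage_BZ (α : Fin (d + 1)) : (fun p : Fin (d + 1) → ℝ => cflip α p) ⁻¹' BZ (d + 1) = BZ (d + 1) :=
  Set.ext fun p => cflip_mem_BZ_iff α p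

/-- [folklore] the flip of one coordinate preserves Lebesgue measure on `ℝ^{d+1}` (coordinatewise: negation resp. identity). -/
theorem measurePreserving_cflip (α : Fin (d + 1)) : MeasurePreserving (fun p : Fin (d + 1) → ℝ => cflip α p) := by
  have h : ∀ i : Fin (d + 1), MeasurePreserving (fun t : ℝ => if i = α then -t else t) := by
    intro i
    by_cases hi : i = α
    · simp only [hi, if_true]; exact Measure.measurePreserving_neg (volume : Measure ℝ)
    · simp only [hi, if_false]; exact MeasurePreserving.id (volume : Measure ℝ)
  exact MeasureTheory.volume_preserving_pi h

/-- [folklore] the flip is measurable. -/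
theorem measurable_cflip (α : Fin (d + 1)) : Measurable (fun p : Fin (d + 1) → ℝ => cflip α p) :=
  (measurePreserving_cflip α).measurable

/-- [folklore] `(cflip α p)·(cflip α x) = p·x`. -/
theorem phase_cflip_cflip (α : Fin (d + 1)) (p : Fin (d + 1) → ℝ) (x : Fin (d + 1) → ℤ) : phase (cflip α p) (cflip α x) = phase p x := by
  unfold B4ContourShift.phase
  refine Finset.sum_congr rfl fun μ _ => ?_
  by_cases hμ : μ = α
  · simp only [cflip_apply, hμ, if_true, Complex.ofReal_neg, Int.cast_neg]; ring
  · simp only [cflip_apply, hμ, if_false]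

/-- [folklore] **THE KERNEL AT THE FLIPPED SITE IS THE KERNEL OF THE FLIPPED SYMBOL**: `K[G](cflip α x) = K[G ∘ cflip α](x)` (the substitution `p ↦ cflip α p` on the
flip-invariant zone; Lebesgue measure is invariant). -/
theorem latticeKernel_cflip (G : (Fin (d + 1) → ℂ) → ℂ) (α : Fin (d + 1)) (x : Fin (d + 1) → ℤ) :
    latticeKernel G (cflip α x) = latticeKernel (fun q => G (cflip α q)) x := by
  unfold latticeKernel B4ContourShift.fourierBox
  congr 1
  have hmp := measurePreserving_cflip (d := d) α
  have h := hmp.setIntegral_preimage_emb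
    (MeasurableEquiv.ofInvolutive (fun p : Fin (d + 1) → ℝ => cflip α p) (cflip_cflip α) (measurable_cflip α)).measurableEmbedding
    (B4ContourShift.integrand G (cflip α x)) (BZ (d + 1))
  rw [cflip_preimage_BZ] at h
  rw [← h]
  refine setIntegral_congr_fun measurableSet_Icc fun p _ => ?_
  unfold B4ContourShift.integrand
  rw [ofRealVec_cflip, phase_cflip_cflip]

/-- [folklore] `phaseC q e_α = q_α`. -/
theorem phaseC_unitVec (q : Fin (d + 1) → ℂ) (α : Fin (d + 1)) : phaseC q (unitVec α) = q α := by
  unfold phaseC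
  simp [unitVec_apply, Finset.sum_ite_eq', Finset.mem_univ]

/-- [folklore] `phaseC q (−e_α) = −q_α`. -/
theorem phaseC_neg_unitVec (q : Fin (d + 1) → ℂ) (α : Fin (d + 1)) : phaseC q (-unitVec α) = -q α := by
  unfold phaseC
  simp [unitVec_apply, Finset.sum_ite_eq', Finset.mem_univ]

/-- [folklore] `phaseC q 0 = 0`. -/
theorem phaseC_zero_right (q : Fin (d + 1) → ℂ) : phaseC q 0 = 0 := by
  unfold phaseC; simp

/-! ## §3 The single-axis reflection law of `PinfKer` -/

/-- [folklore] on the real zone the flipped symbol is a unit shift phase times a sign times the symbol: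
`symP β γ (cflip α q) = e^{i q·sh} · (ε_β ε_γ · symP β γ q)`, `sh = −[β=α]e_α + [γ=α]e_α`, at `q = ofRealVec p`. -/
theorem symP_cflip_ofRealVec (α β γ : Fin (d + 1)) (p : Fin (d + 1) → ℝ) :
    symP β γ (cflip α (ofRealVec p))
      = cexp (I * phaseC (ofRealVec p) (-(if β = α then unitVec α else 0) + (if γ = α then unitVec α else 0)))
        * (((reflSign α β * reflSign α γ : ℝ) : ℂ) * symP β γ (ofRealVec p)) := by
  rw [symP_cflip, reVec_ofRealVec]
  have hq : (ofRealVec p) α = (p α : ℂ) := rfl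
  by_cases hβ : β = α <;> by_cases hγ : γ = α
  · -- both indices on the reflected axis: the phases cancel
    have h1 := self_mul_conj_of_norm (norm_rebasePhase α p) α
    simp only [if_true] at h1
    simp only [hβ, hγ, if_true, reflSign, neg_add_cancel, phaseC_zero_right, mul_zero, Complex.exp_zero, one_mul]
    push_cast
    linear_combination (symP α α (ofRealVec p)) * h1
  · subst hβ
    simp only [hγ, if_true, if_false, reflSign, add_zero, phaseC_neg_unitVec, hq, map_one, mul_one]
    push_cast
    rw [show I * -(p β : ℂ) = -(I * (p β : ℂ)) by ring]
    ring
  · subst hγ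
    simp only [hβ, if_true, if_false, reflSign, neg_zero, zero_add, phaseC_unitVec, hq, one_mul, map_neg, ← Complex.exp_conj, map_mul,
      Complex.conj_I, Complex.conj_ofReal]
    push_cast
    rw [show -(-I * (p γ : ℂ)) = I * (p γ : ℂ) by ring]
    ring
  · simp only [hβ, hγ, if_false, reflSign, neg_zero, add_zero, phaseC_zero_right, mul_zero, Complex.exp_zero, one_mul, map_one, mul_one]
    push_cast
    ring

/-- [our object] **THE SINGLE-AXIS REFLECTION LAW OF THE PERFECT PROPAGATOR KERNEL**:
`PinfKer β γ (cflip α x) = ε_β ε_γ · PinfKer β γ (x − [β=α]e_α + [γ=α]e_α)` (`ε = reflSign α`; change of variables `latticeKernel_cflip`, the flipped symbol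
`symP_cflip_ofRealVec`, the phase shifts the site `latticeKernel_phase_mul`). -/
theorem PinfKer_cflip (α β γ : Fin (d + 1)) (x : Fin (d + 1) → ℤ) :
    PinfKer β γ (cflip α x)
      = ((reflSign α β * reflSign α γ : ℝ) : ℂ) * PinfKer β γ (x + (-(if β = α then unitVec α else 0) + (if γ = α then unitVec α else 0))) := by
  unfold PinfKer
  rw [latticeKernel_cflip]
  rw [latticeKernel_congr (G2 := fun q => cexp (I * phaseC q (-(if β = α then unitVec α else 0) + (if γ = α then unitVec α else 0)))
      * ((fun q => ((reflSign α β * reflSign α γ : ℝ) : ℂ) * symP β γ q) q)) (fun p _ => symP_cflip_ofRealVec α β γ p)]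
  rw [latticeKernel_phase_mul, latticeKernel_const_mul]

/-- [folklore] re-basing the reflected site: `cflip α (cflip α x − u + v) …` — the vector identity used to pass between the two spellings of the law. -/
theorem cflip_shift (α β γ : Fin (d + 1)) (x : Fin (d + 1) → ℤ) :
    cflip α (x + (if β = α then unitVec α else 0) - (if γ = α then unitVec α else 0))
      = cflip α x - (if β = α then unitVec α else 0) + (if γ = α then unitVec α else 0) := by
  funext i
  simp only [cflip_apply, Pi.add_apply, Pi.sub_apply]
  by_cases hi : i = α <;> by_cases hβ : β = α <;> by_cases hγ : γ = α <;> simp [hi, hβ, hγ, unitVec_apply] <;> ring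

/-- [folklore] `cflip α` on lattice points is `PolarizationSign.axisReflect α`. -/
theorem cflip_eq_axisReflect (α : Fin (d + 1)) (x : Fin (d + 1) → ℤ) : cflip α x = axisReflect α x := by
  funext i; simp only [cflip_apply, axisReflect_apply]

/-- [our object] **THE LAW IN THE PRINTED SHAPE**: `PinfKer β γ (εx − [β=α]e_α + [γ=α]e_α) = ε_β ε_γ · PinfKer β γ x`. -/
theorem PinfKer_axisReflect (α β γ : Fin (d + 1)) (x : Fin (d + 1) → ℤ) :
    PinfKer β γ (axisReflect α x - (if β = α then unitVec α else 0) + (if γ = α then unitVec α else 0))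
      = ((reflSign α β * reflSign α γ : ℝ) : ℂ) * PinfKer β γ x := by
  have h := PinfKer_cflip α β γ (x + (if β = α then unitVec α else 0) - (if γ = α then unitVec α else 0))
  rw [cflip_shift, cflip_eq_axisReflect] at h
  rw [h]
  congr 2
  abel

/-- [our object] **`Re PinfKer` IS REFLECTION COVARIANT IN THE TYPED SENSE**: read as a two-index kernel of one lattice variable on `ℤ⁴`, the real part of the explicit
perfect propagator kernel satisfies `PolarizationSign.AxisReflectionCovariant` verbatim. -/
theorem axisReflectionCovariant_re_PinfKer : AxisReflectionCovariant (fun β γ (x : Fin 4 → ℤ) => (PinfKer (d := 3) β γ x).re) := by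
  intro α β γ x
  show (PinfKer (d := 3) β γ (axisReflect α x - (if β = α then unitVec α else 0) + (if γ = α then unitVec α else 0))).re
    = reflSign α β * reflSign α γ * (PinfKer (d := 3) β γ x).re
  rw [PinfKer_axisReflect, Complex.re_ofReal_mul]

/-! ## §4 (L-REFL-P): the gluon leg is invariant under the bond-reflection relabelling -/

/-- [folklore] the difference of two relabelled field-leg sites: `(εz + [γ=α]e_α) − (εx + [β=α]e_α) = ε(z − x) − [β=α]e_α + [γ=α]e_α`. -/
theorem legSite_sub (α β γ : Fin (d + 1)) (x z : Fin (d + 1) → ℤ) :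
    axisReflect α z + (if γ = α then unitVec α else 0) - (axisReflect α x + (if β = α then unitVec α else 0))
      = axisReflect α (z - x) - (if β = α then unitVec α else 0) + (if γ = α then unitVec α else 0) := by
  funext i
  simp only [Pi.add_apply, Pi.sub_apply, axisReflect_apply]
  by_cases hi : i = α <;> by_cases hβ : β = α <;> by_cases hγ : γ = α <;> simp [hi, hβ, hγ, unitVec_apply] <;> ring

/-- [our object] **(L-REFL-P) `refK Φ Pker = Pker`** for EVERY leg relabelling `Φ` of the packed fibre whose FIELD legs of type `β` are relabelled by the bond reflection
`y ↦ εy + [β=α]e_α` with sign `ε_β = reflSign α β` (the multiplier legs are unconstrained: `Pker` vanishes on every block touching one). -/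
theorem refK_Pker_eq_of_legMap (α : Fin 4) (Φ : LegMap 4 (Fib 3))
    (hr : ∀ (β : Fin 4) (y : Fin 4 → ℤ), Φ.r (Sum.inl β) y = axisReflect α y + (if β = α then unitVec α else 0))
    (hs : ∀ β : Fin 4, Φ.s (Sum.inl β) = reflSign α β) : refK Φ Pker = Pker := by
  funext x z a b
  rcases a with β | β <;> rcases b with γ | γ
  · rw [refK_apply, hs, hs, hr, hr, Pker_inl_inl, Pker_inl_inl, legSite_sub, PinfKer_axisReflect, Complex.re_ofReal_mul]
    calc reflSign α β * reflSign α γ * (reflSign α β * reflSign α γ * (PinfKer (d := 3) β γ (z - x)).re)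
        = (reflSign α β * reflSign α β) * (reflSign α γ * reflSign α γ) * (PinfKer (d := 3) β γ (z - x)).re := by ring
      _ = (PinfKer (d := 3) β γ (z - x)).re := by
          have h1 : ∀ κ : Fin 4, reflSign α κ * reflSign α κ = 1 := fun κ => by unfold reflSign; split_ifs <;> norm_num
          rw [h1, h1, one_mul, one_mul]
  · rw [refK_apply, Pker_inl_inr, Pker_inl_inr, mul_zero]
  · rw [refK_apply, Pker_inr_inl, Pker_inr_inl, mul_zero]
  · rw [refK_apply, Pker_inr_inr, Pker_inr_inr, mul_zero]

/-- [folklore] the field-leg site map `y ↦ εy + c•e_α` is an involution. -/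
theorem axisReflect_add_smul_involutive (α : Fin (d + 1)) (c : ℤ) :
    Function.Involutive (fun y : Fin (d + 1) → ℤ => axisReflect α y + c • unitVec α) := by
  intro y
  funext i
  simp only [Pi.add_apply, Pi.smul_apply, axisReflect_apply, smul_eq_mul]
  by_cases hi : i = α <;> simp [hi, unitVec_apply]

/-- [our object] **A LEG RELABELLING LEAVING `Pker` INVARIANT EXISTS** for every axis: field legs `y ↦ εy + [β=α]e_α` with signs `reflSign α β`, multiplier legs `y ↦ εy`
with sign `1` (one admissible choice; any other multiplier-leg choice also works by `refK_Pker_eq_of_legMap`). -/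
theorem exists_legMap_refK_Pker (α : Fin 4) :
    ∃ Φ : LegMap 4 (Fib 3), refK Φ Pker = Pker ∧
      (∀ (β : Fin 4) (y : Fin 4 → ℤ), Φ.r (Sum.inl β) y = axisReflect α y + (if β = α then unitVec α else 0)) ∧
      (∀ β : Fin 4, Φ.s (Sum.inl β) = reflSign α β) ∧
      (∀ (β : Fin 4) (y : Fin 4 → ℤ), Φ.r (Sum.inr β) y = axisReflect α y) ∧ (∀ β : Fin 4, Φ.s (Sum.inr β) = 1) := by
  classical
  let rF : Fin 4 → (Fin 4 → ℤ) ≃ (Fin 4 → ℤ) := fun β =>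
    Function.Involutive.toPerm (fun y : Fin 4 → ℤ => axisReflect α y + (if β = α then (1 : ℤ) else 0) • unitVec α)
      (axisReflect_add_smul_involutive α _)
  let rM : (Fin 4 → ℤ) ≃ (Fin 4 → ℤ) :=
    Function.Involutive.toPerm (fun y : Fin 4 → ℤ => axisReflect α y + (0 : ℤ) • unitVec α) (axisReflect_add_smul_involutive α 0)
  let Φ : LegMap 4 (Fib 3) :=
    { r := fun a => match a with
        | Sum.inl β => rF β
        | Sum.inr _ => rM
      s := fun a => match a with
        | Sum.inl β => reflSign α β
        | Sum.inr _ => 1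
      s_mul_s := fun a => by
        rcases a with β | β
        · show reflSign α β * reflSign α β = 1
          unfold reflSign; split_ifs <;> norm_num
        · exact one_mul 1 }
  have hr : ∀ (β : Fin 4) (y : Fin 4 → ℤ), Φ.r (Sum.inl β) y = axisReflect α y + (if β = α then unitVec α else 0) := by
    intro β y
    show axisReflect α y + (if β = α then (1 : ℤ) else 0) • unitVec α = _
    by_cases hβ : β = α <;> simp [hβ]
  have hs : ∀ β : Fin 4, Φ.s (Sum.inl β) = reflSign α β := fun β => rfl
  refine ⟨Φ, refK_Pker_eq_of_legMap α Φ hr hs, hr, hs, fun β y => ?_, fun β => rfl⟩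
  show axisReflect α y + (0 : ℤ) • unitVec α = _
  rw [zero_smul, add_zero]

/-! ## §5 (L-REFL-G): the ghost leg is invariant under the reflected scalar relabelling -/

/-- [folklore] membership in `LatticeGreenFunction`'s zone is a coordinatewise absolute-value bound. -/
theorem mem_brillouin_iff_abs (p : Fin (d + 1) → ℝ) : p ∈ brillouin (d + 1) ↔ ∀ i, |p i| ≤ π := by
  simp only [brillouin, Set.mem_pi, Set.mem_univ, true_implies, Set.mem_Icc, abs_le]

/-- [folklore] the Brillouin zone of `LatticeGreenFunction` is invariant under the flip of one coordinate. -/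
theorem cflip_preimage_brillouin (α : Fin (d + 1)) : (fun p : Fin (d + 1) → ℝ => cflip α p) ⁻¹' brillouin (d + 1) = brillouin (d + 1) := by
  ext p
  simp only [Set.mem_preimage, mem_brillouin_iff_abs]
  refine forall_congr' fun i => ?_
  by_cases hi : i = α
  · rw [cflip_apply, if_pos hi, abs_neg]
  · rw [cflip_apply, if_neg hi]

/-- [folklore] **`latticeGreen (cflip α z) = latticeGreen z`**: the free lattice Green function is invariant under the reflection of one coordinate (substitution
`p ↦ cflip α p` in the zone integral; `cos` and the dispersion are flip-even). -/
theorem latticeGreen_cflip (α : Fin (d + 1)) (z : Fin (d + 1) → ℤ) : latticeGreen (cflip α z) = latticeGreen z := by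
  unfold latticeGreen
  congr 1
  have hmp := measurePreserving_cflip (d := d) α
  have h := hmp.setIntegral_preimage_emb
    (MeasurableEquiv.ofInvolutive (fun p : Fin (d + 1) → ℝ => cflip α p) (cflip_cflip α) (measurable_cflip α)).measurableEmbedding
    (fun p : Fin (d + 1) → ℝ => Real.cos (∑ i, p i * ((cflip α z i : ℤ) : ℝ)) / dispersion p) (brillouin (d + 1))
  rw [cflip_preimage_brillouin] at h
  rw [← h]
  refine setIntegral_congr_fun (Literature.Probability.LatticeModels.measurableSet_brillouin (d + 1)) fun p _ => ?_
  have e1 : ∑ i, cflip α p i * ((cflip α z i : ℤ) : ℝ) = ∑ i, p i * ((z i : ℤ) : ℝ) := by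
    refine Finset.sum_congr rfl fun i _ => ?_
    by_cases hi : i = α
    · simp only [cflip_apply, hi, if_true, Int.cast_neg]; ring
    · simp only [cflip_apply, hi, if_false]
  have e2 : dispersion (cflip α p) = dispersion p := by
    unfold dispersion
    refine Finset.sum_congr rfl fun i _ => ?_
    by_cases hi : i = α
    · simp only [cflip_apply, hi, if_true, Real.cos_neg]
    · simp only [cflip_apply, hi, if_false]
  show Real.cos (∑ i, cflip α p i * ((cflip α z i : ℤ) : ℝ)) / dispersion (cflip α p) = Real.cos (∑ i, p i * ((z i : ℤ) : ℝ)) / dispersion p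
  rw [e1, e2]

/-- [our object] **(L-REFL-G) `refK Ψ G0ker = G0ker`** for EVERY scalar-leg relabelling by `y ↦ εy + c•e_α` (any offset `c`, any sign with `s·s = 1`). -/
theorem refK_G0ker_eq_of_legMap (α : Fin 4) (Ψ : LegMap 4 Unit) (c : ℤ)
    (hr : ∀ y : Fin 4 → ℤ, Ψ.r () y = axisReflect α y + c • unitVec α) : refK Ψ G0ker = G0ker := by
  funext x z a b
  rcases a with ⟨⟩; rcases b with ⟨⟩
  rw [refK_apply, hr, hr, G0ker_apply, G0ker_apply, Ψ.s_mul_s, one_mul]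
  have e : axisReflect α z + c • unitVec α - (axisReflect α x + c • unitVec α) = cflip α (z - x) := by
    funext i
    simp only [Pi.add_apply, Pi.sub_apply, Pi.smul_apply, axisReflect_apply, cflip_apply, smul_eq_mul]
    by_cases hi : i = α
    · simp only [hi, if_true, unitVec_apply, mul_one]; ring
    · simp only [hi, if_false, unitVec_apply, mul_zero, add_zero]
  rw [e, latticeGreen_cflip]

/-- [our object] **A SCALAR-LEG RELABELLING LEAVING `G0ker` INVARIANT EXISTS** for every axis and every offset `c`: `y ↦ εy + c•e_α`, sign `1`. -/
theorem exists_legMap_refK_G0ker (α : Fin 4) (c : ℤ) :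
    ∃ Ψ : LegMap 4 Unit, refK Ψ G0ker = G0ker ∧ (∀ y : Fin 4 → ℤ, Ψ.r () y = axisReflect α y + c • unitVec α) ∧ Ψ.s () = 1 := by
  let Ψ : LegMap 4 Unit :=
    { r := fun _ => Function.Involutive.toPerm (fun y : Fin 4 → ℤ => axisReflect α y + c • unitVec α) (axisReflect_add_smul_involutive α c)
      s := fun _ => 1
      s_mul_s := fun _ => one_mul 1 }
  exact ⟨Ψ, refK_G0ker_eq_of_legMap α Ψ c (fun y => rfl), fun y => rfl, rfl⟩

end Summit.QuantumFields.BalabanUV.Beta.FP.PerfectPropagatorReflection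

end
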